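/-
Copyright: statement-level skeleton of a published paper (lit-balaban cell, Phase-2 proof seat p13, gen 9). No proof
claims beyond what the kernel checks below.
-/
import Literature.MathematicalPhysics.QuantumFieldTheory.BalabanImbrieJaffe1984to88.BIJ88F1Localized290
import Literature.MathematicalPhysics.QuantumFieldTheory.BalabanImbrieJaffe1984to88.BIJ88Expansion577Bounds

/-!
# `BalabanImbrieJaffe1984to88.BIJ88F1Expansion577` — T. Bałaban, J. Imbrie, A. Jaffe, *Effective action and cluster
properties of the abelian Higgs model*, Commun. Math. Phys. **114** (1988) 257–315 [BalabanImbrieJaffe1988]: Sect. 5.7,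
p. 290 — *"These expansions can be inserted into V_j"*: the expansion of `F_{1,j}(Ã̃^ζ_b)` of the first p. 290 display (file 1a
`BIJ88F1Localized290`) IS an input expansion of the (5.7.7) calculus (file 2a `BIJ88Expansion577`): its order-`≤ n̄` part is
`Σ_{n=1}^{n̄} ζ^{−1}(ie_jζÃ̃_b)ⁿ/n!`, its localized part is `F_{1,j,b}(X)`; it is of positive order, rooted at the cube of `b`, lives on
connected regions, and its two sizes are bounded as the (5.7.7) size clause (file 2b) consumes them — the localized size by
the LATTICE-ANIMAL bound (file 4 of seat p13 gen 9).

statement-level skeleton of published theorems with citation tags; proofs where landed; nothing here is a claim about the Yang–Mills mass gap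

PDF held: `paper:balaban1988-cmp114-bij-abelian-higgs-effective-action` (journal page = PDF page + 256); pp. 289–290
[PDF 33–34] read as IMAGES (CCITT renders; copies `HOME/lit-balaban-p13/pages/`).

CITATION HEADER (lean-in-tree rule).  Part of the lit-balaban TYPED SKELETON (HOME `run/shared/lean/pub/lit-balaban/`):
WHAT IS REPRODUCED = row **C2.Eq5.7.7-5.7.9** of `HOME/lit-balaban-r16/ROWS-C2-part2.md`, member (5.7.7) — the link between
the p. 290 expansion display and (5.7.7).  Unit `lit-balaban-p13` (gen 9), owner r16, referee ref-5.  Built BY NAME on file 1a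
(`LocDatum`, `F1loc`, `f1_display`, `norm_F1loc_le`), 2a/2b (`GLExp`, `val`, `Rooted`, `Conn`, `lowNormW`, `actNorm`), r16's
`BIJ88Sect5Statements.F1`, gen 8's `cubePolymers` and the tree's `Literature.Probability.LatticeModels.sum_pow_card_le_of_connected`;
nothing restated.

## What is kernel-checked here

* `glF1` — the expansion: `low n = ζ^{−1}(iζÃ̃_b)ⁿ/n!` for `1 ≤ n ≤ n̄` (the coefficient of `e_jⁿ`), `act X = F_{1,j,b}(X)`;
  **`val_glF1`** (`val = ζ^{−1}F₁(ie_jζÃ̃_b)`, from `f1_display`), `glF1_low_zero` (positive order: *"each term … has at least one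
  factor e_j"*).
* `exists_assoc_of_F1loc_ne_zero` (`F_{1,j,b}(X) ≠ 0 ⇒ X` is a region of the association), hence **`glF1_rooted`** (the regions
  contain the cube of `b`) and **`glF1_conn`** (*"a connected union of r(e_k)-cubes containing them"*) from the corresponding
  properties of the association (p36's `assocZd` has both: `cube_mem_assocZd`, `assocZd_connected`).
* the sizes: `abs_total_le_radius`, **`lowNormW_glF1_le`** (`Σ_{n≤n̄} ρⁿ‖low n‖ ≤ ρR·e^{ρζR}`, `R` = the field size `radius`),
  **`actNorm_glF1_le`** (`Σ_X ‖F_{1,j,b}(X)‖e^{κ′|X|⁻} ≤ 2δ₀` with `δ₀ = ζ^{n̄}(e_j(p+1))^{n̄+1}e^{e_jζ(p+1)}/(n̄+1)!` the constant of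
  `norm_F1loc_le`, for every `κ′` with `(Δ+1)²e^{−(κ−κ′)} ≤ ½` — the decay left over after weighting is summed over the
  connected regions through the cube of `b` by the lattice-animal bound).

HONEST SCOPE.  Model level as in 1a/2a: the kernel row `w₅(b,·)`, the field `A′`, the local part and the association are
inputs; the (5.7.6) shape `|w_{b,m}(X)| ≤ e^{−κ|X|}` (`m ≥ 1`) is a hypothesis here (discharged on `ℤ^d` by p36's `ineq576_Zd`,
see 1b).  Definitions with bodies (`glF1`) + theorems; no `Prop` facts; axioms standard.
-/

noncomputable section

open scoped BigOperators
open Complex Finset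

namespace Literature.MathematicalPhysics.QuantumFieldTheory.BalabanImbrieJaffe1984to88.BIJ88F1Expansion577

open BIJ88Sect5Statements (F1)
open BIJ88Sect5StatementsPart2 (PolymerSys)
open BIJ88F1Localized290 (wloc LocDatum)
open BIJ88Expansion577 BIJ88Expansion577.GLExp BIJ88Expansion577Bounds
open BIJ88TraceTerms579 (cubePolymers)
open Literature.Probability.LatticeModels (IsRConnected)

variable {ι : Type} [DecidableEq ι] {β : Type*} [Fintype β]

/-! ## §1 The expansion of `F_{1,j}(Ã̃_b)` as a (5.7.7) input -/

/-- **the expansion of `F_{1,j}(Ã̃^ζ_b) = ζ^{−1}F₁(ie_jζÃ̃_b)`** in the sense of (5.7.7): order-`≤ n̄` coefficients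
`ζ^{−1}(iζÃ̃_b)ⁿ/n!` (`1 ≤ n ≤ n̄`; times `e_jⁿ` this is the `n`-th term of the first p. 290 display), localized part
`F_{1,j,b}(X)` of file 1a. [cite: BalabanImbrieJaffe1988, (5.7.7) p.290] -/
def glF1 (D : LocDatum β (Finset ι)) (ej ζ : ℝ) (nbar : ℕ) : GLExp ι :=
  ⟨fun n => if 1 ≤ n ∧ n ≤ nbar then (ζ : ℂ)⁻¹ * (I * (ζ * D.total : ℝ)) ^ n / (n.factorial : ℂ) else 0,
   fun X => D.F1loc ej ζ nbar X⟩

variable (D : LocDatum β (Finset ι)) (ej ζ : ℝ) (nbar : ℕ)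

/-- positive order: no `e_j⁰` coefficient (*"Each term … has at least one factor e_j"*, p. 289).
[cite: BalabanImbrieJaffe1988, (5.7.7) p.290] -/
theorem glF1_low_zero : (glF1 D ej ζ nbar).low 0 = 0 := by
  simp [glF1]

/-- the order-`≤ n̄` part is the first sum of the p. 290 display: `Σ_{n ≤ n̄} e_jⁿ·low n = Σ_{n=1}^{n̄} ζ^{−1}(ie_jζÃ̃_b)ⁿ/n!`.
[cite: BalabanImbrieJaffe1988, (5.7.7) p.290] -/
theorem lowVal_glF1 : (glF1 D ej ζ nbar).lowVal nbar ej =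
    ∑ n ∈ range nbar, (ζ : ℂ)⁻¹ * (I * (ej * ζ * D.total : ℝ)) ^ (n + 1) / (n + 1).factorial := by
  unfold GLExp.lowVal
  rw [Finset.sum_range_succ']
  have h0 : (glF1 D ej ζ nbar).low 0 = 0 := glF1_low_zero D ej ζ nbar
  rw [h0, mul_zero, add_zero]
  refine Finset.sum_congr rfl fun n hn => ?_
  have hn' : 1 ≤ n + 1 ∧ n + 1 ≤ nbar := ⟨Nat.succ_pos n, Finset.mem_range.mp hn⟩
  simp only [glF1, if_pos hn']
  push_cast
  ring

/-- **`val (glF1) = ζ^{−1}F₁(ie_jζÃ̃_b)`** — the expansion represents `F_{1,j}(Ã̃^ζ_b)` (file 1a's `f1_display` over all regions).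
[cite: BalabanImbrieJaffe1988, (5.7.7) p.290] -/
theorem val_glF1 [Fintype ι] : (glF1 D ej ζ nbar).val nbar ej = (ζ : ℂ)⁻¹ * F1 (I * (ej * ζ * D.total : ℝ)) := by
  rw [GLExp.val, lowVal_glF1, D.f1_display Finset.univ (fun _ _ => Finset.mem_univ _) ej ζ nbar]
  rfl

/-! ## §2 Rooted and connected: the regions of `F_{1,j,b}(X)` are regions of the association -/

/-- a non-zero localized power exhibits a region of the association: `powLoc n X ≠ 0 ⇒ ∃ m t, assoc m t = X`.
[cite: BalabanImbrieJaffe1988, (5.7.5) p.289] -/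
theorem exists_assoc_of_powLoc_ne_zero {n : ℕ} {X : Finset ι} (h : D.powLoc n X ≠ 0) :
    ∃ m, ∃ t : Fin m → β, D.assoc m t = X := by
  classical
  obtain ⟨m, -, hm⟩ := Finset.exists_ne_zero_of_sum_ne_zero h
  have hw : wloc D.wr D.A' m (D.assoc m) X ≠ 0 := right_ne_zero_of_mul hm
  obtain ⟨t, ht, -⟩ := Finset.exists_ne_zero_of_sum_ne_zero hw
  exact ⟨m, t, (Finset.mem_filter.mp ht).2⟩

/-- **`F_{1,j,b}(X) ≠ 0 ⇒ X` is a region of the association** (a series of zeros is zero).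
[cite: BalabanImbrieJaffe1988, (5.7.7) p.290] -/
theorem exists_assoc_of_F1loc_ne_zero {X : Finset ι} (h : D.F1loc ej ζ nbar X ≠ 0) :
    ∃ m, ∃ t : Fin m → β, D.assoc m t = X := by
  classical
  by_contra hne
  apply h
  have hzero : ∀ n, D.powLoc n X = 0 := fun n => by
    by_contra hp
    exact hne (exists_assoc_of_powLoc_ne_zero D hp)
  unfold LocDatum.F1loc LocDatum.locRem
  simp [hzero]

/-- **ROOTED**: if every region of the association contains the cube `c₀` of `b` (*"a set X … containing them"*; p36's
`cube_mem_assocZd`), the expansion of `F_{1,j}` is rooted at `c₀`. [cite: BalabanImbrieJaffe1988, (5.7.7) p.290] -/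
theorem glF1_rooted {c₀ : ι} (hroot : ∀ m (t : Fin m → β), c₀ ∈ D.assoc m t) : Rooted c₀ (glF1 D ej ζ nbar) := by
  intro X hX
  obtain ⟨m, t, ht⟩ := exists_assoc_of_F1loc_ne_zero D ej ζ nbar hX
  exact ht ▸ hroot m t

/-- **CONNECTED**: if every region of the association is an `R`-connected union of cubes (p36's `assocZd_connected`), the
expansion of `F_{1,j}` lives on connected regions. [cite: BalabanImbrieJaffe1988, (5.7.7) p.290] -/
theorem glF1_conn {R : ι → ι → Prop} (hconn : ∀ m (t : Fin m → β), IsRConnected R (D.assoc m t)) :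
    Conn R (glF1 D ej ζ nbar) := by
  intro X hX
  obtain ⟨m, t, ht⟩ := exists_assoc_of_F1loc_ne_zero D ej ζ nbar hX
  exact ht ▸ hconn m t

/-! ## §3 The two sizes -/

omit [DecidableEq ι] in
/-- `|Ã̃_b| ≤ radius` (`= |a_loc| + Σ|w₅(b,b′)||A′(b′)|`). [cite: BalabanImbrieJaffe1988, (5.7.6) p.290] -/
theorem abs_total_le_radius : |D.total| ≤ D.radius := by
  unfold LocDatum.total LocDatum.nonloc LocDatum.radius
  refine (abs_add_le _ _).trans (add_le_add le_rfl ((Finset.abs_sum_le_sum_abs _ _).trans (le_of_eq ?_)))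
  exact Finset.sum_congr rfl fun b' _ => abs_mul _ _

/-- `Σ_{n=1}^{N} xⁿ/n! ≤ x·e^{x}` for `x ≥ 0` (shift + partial sums of the exponential). [folklore] -/
private theorem sum_pow_div_factorial_succ_le {x : ℝ} (hx : 0 ≤ x) (N : ℕ) :
    ∑ n ∈ range N, x ^ (n + 1) / ((n + 1).factorial : ℝ) ≤ x * Real.exp x := by
  calc ∑ n ∈ range N, x ^ (n + 1) / ((n + 1).factorial : ℝ)
      ≤ ∑ n ∈ range N, x * (x ^ n / (n.factorial : ℝ)) := by
        refine Finset.sum_le_sum fun n _ => ?_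
        rw [pow_succ', mul_div_assoc]
        refine mul_le_mul_of_nonneg_left (div_le_div_of_nonneg_left (pow_nonneg hx _) (by positivity) ?_) hx
        exact_mod_cast Nat.factorial_le (Nat.le_succ n)
    _ = x * ∑ n ∈ range N, x ^ n / (n.factorial : ℝ) := by rw [Finset.mul_sum]
    _ ≤ x * Real.exp x := mul_le_mul_of_nonneg_left (Real.sum_le_exp_of_nonneg hx N) hx

/-- **SIZE OF THE ORDER-`≤ n̄` PART** (*"small, bounded kernels"*): for `ζ > 0`, `0 ≤ ρ` and the field size `radius ≤ R`,
`lowNormW ρ (glF1) ≤ ρR·e^{ρζR}`. [cite: BalabanImbrieJaffe1988, (5.7.7) p.290] -/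
theorem lowNormW_glF1_le {ρ R : ℝ} (hζ : 0 < ζ) (hρ : 0 ≤ ρ) (hR : D.radius ≤ R) :
    lowNormW ρ nbar (glF1 D ej ζ nbar) ≤ ρ * R * Real.exp (ρ * ζ * R) := by
  have hR0 : 0 ≤ R := D.radius_nonneg.trans hR
  have htot : |D.total| ≤ R := (abs_total_le_radius D).trans hR
  unfold lowNormW
  rw [Finset.sum_range_succ', glF1_low_zero, norm_zero, mul_zero, add_zero]
  -- the n-th weighted coefficient: ρ^{n+1} ζ^{-1} (ζ|Ã|)^{n+1}/(n+1)! ≤ ζ^{-1} (ρζR)^{n+1}/(n+1)!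
  have hterm : ∀ n ∈ range nbar, ρ ^ (n + 1) * ‖(glF1 D ej ζ nbar).low (n + 1)‖ ≤
      ζ⁻¹ * ((ρ * ζ * R) ^ (n + 1) / ((n + 1).factorial : ℝ)) := by
    intro n hn
    have hn' : 1 ≤ n + 1 ∧ n + 1 ≤ nbar := ⟨Nat.succ_pos n, Finset.mem_range.mp hn⟩
    simp only [glF1, if_pos hn']
    rw [norm_div, norm_mul, norm_inv, Complex.norm_real, Real.norm_eq_abs, abs_of_pos hζ, norm_pow, norm_mul,
      Complex.norm_I, one_mul, Complex.norm_real, Real.norm_eq_abs, abs_mul, abs_of_pos hζ, Complex.norm_natCast]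
    rw [show ρ ^ (n + 1) * (ζ⁻¹ * (ζ * |D.total|) ^ (n + 1) / ((n + 1).factorial : ℝ)) =
      ζ⁻¹ * ((ρ * ζ * |D.total|) ^ (n + 1) / ((n + 1).factorial : ℝ)) by rw [mul_pow, mul_pow, mul_pow]; ring]
    refine mul_le_mul_of_nonneg_left (div_le_div_of_nonneg_right ?_ (by positivity)) (inv_nonneg.mpr hζ.le)
    exact pow_le_pow_left₀ (by positivity) (mul_le_mul_of_nonneg_left htot (by positivity)) _
  refine (Finset.sum_le_sum hterm).trans ?_
  rw [← Finset.mul_sum]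
  calc ζ⁻¹ * ∑ n ∈ range nbar, (ρ * ζ * R) ^ (n + 1) / ((n + 1).factorial : ℝ)
      ≤ ζ⁻¹ * ((ρ * ζ * R) * Real.exp (ρ * ζ * R)) :=
        mul_le_mul_of_nonneg_left (sum_pow_div_factorial_succ_le (by positivity) nbar) (inv_nonneg.mpr hζ.le)
    _ = ρ * R * Real.exp (ρ * ζ * R) := by field_simp

/-- **SIZE OF THE LOCALIZED PART** (the input `δ` of the (5.7.7) size clause): with the hypotheses of file 1a's
`norm_F1loc_le` ((5.7.6) shape `|w_{b,m}(X)| ≤ M^m e^{−κ|X|}` for `m ≥ 1`, `|a_loc| ≤ p`, the empty collection on one cube), the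
association rooted at `c₀` and `R`-connected for a symmetric cube adjacency of degree `≤ Δ`, and a weight rate `κ′` with
`(Δ+1)²e^{−(κ−κ′)} ≤ ½` (so `κ′ < κ`): `Σ_X ‖F_{1,j,b}(X)‖e^{κ′|X|⁻} ≤ 2δ₀`, `δ₀ = ζ^{n̄}(e_j(p+M))^{n̄+1}e^{e_jζ(p+M)}/(n̄+1)!` — the decay
`e^{−(κ−κ′)|X|⁻}` left over is summed over the connected regions through `c₀` (lattice animals).
[cite: BalabanImbrieJaffe1988, (5.7.7) p.290] -/
theorem actNorm_glF1_le [Fintype ι] {R : ι → ι → Prop} (hR : ∀ x y, R x y → R y x) {nbr : ι → Finset ι}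
    {Δ : ℕ} (hΔ : ∀ x, (nbr x).card ≤ Δ) (hnbr : ∀ x y, R x y → y ∈ nbr x) {c₀ : ι}
    (hroot : ∀ m (t : Fin m → β), c₀ ∈ D.assoc m t) (hconn : ∀ m (t : Fin m → β), IsRConnected R (D.assoc m t))
    {p M κ κ' : ℝ} (hej : 0 ≤ ej) (hζ : 0 < ζ) (hp : |D.aloc| ≤ p) (hM : 0 ≤ M) (hκ : 0 ≤ κ)
    (h576 : ∀ m, 1 ≤ m → ∀ X, |wloc D.wr D.A' m (D.assoc m) X| ≤ M ^ m * Real.exp (-κ * (cubePolymers ι).card X))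
    (h0 : ∀ t : Fin 0 → β, (cubePolymers ι).card (D.assoc 0 t) ≤ 1)
    (hsmall : ((Δ : ℝ) + 1) ^ 2 * Real.exp (-(κ - κ')) ≤ 1 / 2) :
    (glF1 D ej ζ nbar).actNorm κ' ≤
      2 * (ζ ^ nbar * (ej * (p + M)) ^ (nbar + 1) / ((nbar + 1).factorial : ℝ) * Real.exp (ej * ζ * (p + M))) := by
  set δ₀ : ℝ := ζ ^ nbar * (ej * (p + M)) ^ (nbar + 1) / ((nbar + 1).factorial : ℝ) * Real.exp (ej * ζ * (p + M)) with hδ₀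
  set lam : ℝ := Real.exp (-(κ - κ')) with hlam
  have hδ₀0 : 0 ≤ δ₀ := by
    have : 0 ≤ p := (abs_nonneg _).trans hp
    positivity
  have hlam0 : 0 < lam := Real.exp_pos _
  -- pointwise: the F1loc bound of file 1a
  have hpt : ∀ X : Finset ι, ‖D.F1loc ej ζ nbar X‖ ≤ δ₀ * Real.exp (-κ * (cubePolymers ι).cardMinus X) := fun X =>
    D.norm_F1loc_le ⟨Finset ι, Finset.card⟩ hej hζ hp hM hκ h576 h0 nbar X
  -- the family of regions carrying F1loc (connectedness is not decidable by instance search: go classical)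
  classical
  set fam : Finset (Finset ι) := Finset.univ.filter (fun X => c₀ ∈ X ∧ IsRConnected R X) with hfam
  unfold GLExp.actNorm
  -- restrict the sum to the family (all other terms vanish)
  have hvanish : ∀ X : Finset ι, X ∉ fam → ‖(glF1 D ej ζ nbar).act X‖ * Real.exp (κ' * (cubePolymers ι).cardMinus X) = 0 := by
    intro X hX
    have hz : D.F1loc ej ζ nbar X = 0 := by
      by_contra h
      obtain ⟨m, t, ht⟩ := exists_assoc_of_F1loc_ne_zero D ej ζ nbar h
      exact hX (Finset.mem_filter.mpr ⟨Finset.mem_univ _, ht ▸ hroot m t, ht ▸ hconn m t⟩)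
    show ‖D.F1loc ej ζ nbar X‖ * _ = 0
    rw [hz, norm_zero, zero_mul]
  rw [← Finset.sum_subset (Finset.subset_univ fam) fun X _ hX => hvanish X hX]
  -- on the family: ‖F1loc X‖ e^{κ'|X|⁻} ≤ δ₀ λ^{|X|⁻} = δ₀ λ⁻¹ λ^{|X|}
  have hmem : ∀ X ∈ fam, ‖(glF1 D ej ζ nbar).act X‖ * Real.exp (κ' * (cubePolymers ι).cardMinus X) ≤
      δ₀ * lam⁻¹ * lam ^ X.card := by
    intro X hX
    have hc : c₀ ∈ X := (Finset.mem_filter.mp hX).2.1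
    have hcard : (cubePolymers ι).cardMinus X + 1 = X.card := by
      show X.card - 1 + 1 = X.card
      exact Nat.sub_add_cancel (Finset.card_pos.mpr ⟨c₀, hc⟩)
    show ‖D.F1loc ej ζ nbar X‖ * _ ≤ _
    calc ‖D.F1loc ej ζ nbar X‖ * Real.exp (κ' * (cubePolymers ι).cardMinus X)
        ≤ δ₀ * Real.exp (-κ * (cubePolymers ι).cardMinus X) * Real.exp (κ' * (cubePolymers ι).cardMinus X) :=
          mul_le_mul_of_nonneg_right (hpt X) (Real.exp_pos _).le
      _ = δ₀ * lam ^ (cubePolymers ι).cardMinus X := by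
          rw [mul_assoc, ← Real.exp_add, hlam, ← Real.exp_nat_mul]
          congr 2; ring
      _ = δ₀ * lam⁻¹ * lam ^ X.card := by
          rw [← hcard, pow_succ]
          field_simp
  refine (Finset.sum_le_sum hmem).trans ?_
  rw [← Finset.mul_sum]
  have hanimal : ∑ X ∈ fam, lam ^ X.card ≤ 2 * lam :=
    Literature.Probability.LatticeModels.sum_pow_card_le_of_connected hR hΔ hnbr hlam0.le
      (by rw [hlam]; exact hsmall) c₀ fam fun X hX => (Finset.mem_filter.mp hX).2
  calc δ₀ * lam⁻¹ * ∑ X ∈ fam, lam ^ X.card ≤ δ₀ * lam⁻¹ * (2 * lam) :=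
        mul_le_mul_of_nonneg_left hanimal (mul_nonneg hδ₀0 (inv_nonneg.mpr hlam0.le))
    _ = 2 * δ₀ := by field_simp

end Literature.MathematicalPhysics.QuantumFieldTheory.BalabanImbrieJaffe1984to88.BIJ88F1Expansion577

end
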